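import Summits.ResolutionOfSingularities.ResolutionOfSingularities.Theorems.DescentDescentPerfectToAllLevelResolution
import Literature.AlgebraicGeometry.Limits.FiniteTypeModelDescent
import Literature.AlgebraicGeometry.Dimension.GenericFibreDimensionBound
import Literature.AlgebraicGeometry.Resolution.ResolutionOfComponents
import Literature.RingTheory.KrullDimension.AffineDimension
import Literature.AlgebraicGeometry.Resolution.AlterationsStrong
import Literature.AlgebraicGeometry.Resolution.AffineDomainDimension
import Mathlib.FieldTheory.RatFunc.AsPolynomial
import Mathlib.RingTheory.KrullDimension.Polynomial
import HarnessLib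

/-!
# [OURS · L1 W8.2] GRADED FAMILY TRANSFER along a finitely generated field extension — the CORE theorem
# (rung B, prime-field / family transfer): resolution over `k` in dimension `≤ n + d` ⇒ resolution over
# `K = Frac A` in dimension `≤ n`, for `A` a finitely generated `k`-domain of dimension `≤ d`

Cell `res-hironaka` (run/shared/lean/pub/res-hironaka/), LADDER-RESOLUTION rung L (RESCUE), slot W8.2 of
plan/RESCUE-SEED.md («PRIME-FIELD / UNIVERSALITY TRANSFER instead of descent: resolve over 𝔽_p or F̄_p and
transfer FAMILIES»; barrier reading of the row: «transfer must be of FAMILIES with regular total space, not of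
fibres»), host route `UniversalCells`, host item `PrimeFieldToPerfect` (stmt-ResolutionOfSingularities-15233).
Prover res-L1-s82-pv-1. THESES-FREE module (cell build rule (B)): imports only Theses-free `Theorems` files,
`Literature.*`, Mathlib. Stated in the tree's vocabulary `IntegralResolutionOverUpToDim` /
`ResolutionOverUpToDim` (Literature/AlgebraicGeometry/Resolution/{ResolutionOfComponents,ArithmeticalThreefolds}.lean);
the slot's OURS names `CampaignW82.FgFieldTransferShift` / `FamilyTransferSucc`
(Theorems/UniversalCellsCampaignW82FamilyTransferGraded.lean) are discharged from this file in
Theorems/UniversalCellsCampaignW82FamilyTransferGradedProofs.lean.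

WHAT IS PROVED (sorry-free; unconditional; any characteristic; no perfectness):

* `integralResolutionOverUpToDim_of_isFractionRing` — **THE GRADED FAMILY TRANSFER.** Let `k ⊆ K` be fields
  with `K = Frac A` for a finitely generated `k`-domain `A` of Krull dimension `≤ d` (i.e. `K/k` finitely
  generated of transcendence degree `≤ d`). If every integral separated `k`-scheme of finite type of dimension
  `≤ n + d` has a resolution of singularities, then so does every integral separated `K`-scheme of finite type
  of dimension `≤ n`. MECHANISM = half (a) of the crux with dimension bookkeeping — transfer of a FAMILY with
  regular total space, not of fibres: spread `X → Spec K` out to an INTEGRAL model `𝒳 → Spec R` over a finitely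
  generated `k`-subalgebra `R ⊆ K` with `Frac R = K` (`Limits.exists_isPullback_specMap_subalgebra` +
  `Limits.exists_isPullback_toImage_of_isLocallyNoetherian` on the subalgebra diagram, the model being the
  scheme-theoretic image of `X`, hence integral); `dim R = trdeg_k K = dim A ≤ d` (Matsumura Thm. 5.6,
  `Literature.RingTheory.KrullDimension.ringKrullDim_eq_trdeg`); `dim 𝒳 ≤ n + d` by the dimension inequality
  from the generic fibre (`Dimension.topologicalKrullDim_le_of_isPullback_genericFibre_of_irreducibleSpace`,
  Matsumura Thm. 15.5); resolve the TOTAL SPACE `𝒳` as a `k`-scheme; the generic fibre of that resolution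
  resolves `X ≅ 𝒳 ×_R Spec K` (`Theorems.hasResolution_pullback_of_flat_of_surjectiveOnStalks`: `Spec K → Spec R`
  is a flat preimmersion, the local rings of the generic fibre are local rings of the regular total space). No
  ground-field extension occurs, so the transport barriers of the row
  (`Literature/Barriers/ResolutionOfSingularities/{RegularNotGeometricallyRegular, InseparableBaseChangeResolution,
  FrobeniusTwistResolution}.lean`) are not met.
* `resolutionOverUpToDim_of_isFractionRing` — the same for REDUCED schemes, through
  `resolutionOverUpToDim_iff_integral`.
* `integralResolutionOverUpToDim_of_trdeg_le` — the same with the hypothesis `trdeg_k K ≤ d` for `K = Frac A`,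
  `A ⊆ K` any finitely generated `k`-subalgebra. At `k = ZMod p` this is the GRADED HALF (a) of the crux
  (`CampaignW82.PrimeToFg p` graded by dimension; not restated with `ZMod p` here).
* `integralResolutionOverUpToDim_ratFunc` / `resolutionOverUpToDim_ratFunc` — one transcendental, `(n + 1, n)`:
  resolution over `k` in dimension `≤ n + 1` ⇒ resolution over `RatFunc k` in dimension `≤ n` (`A = k[X]`).
  E.g. resolution of fivefolds over `𝔽_p` ⇒ resolution of fourfolds over `𝔽_p(t)`.
* `integralResolutionOverUpToDim_fractionRing_mvPolynomial` — `r` transcendentals, `(n + r, n)`.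
* `integralRes_of_isFractionRing` — the UNGRADED form (all dimensions over `k` ⇒ all dimensions over `K`):
  `Theorems.PrimeFieldToPerfect.stub_spreadOut` (p149455: `k = ZMod p`, `K` finitely generated as a field)
  with the prime field replaced by an arbitrary ground field.

HONEST FRAMING. [OURS · L1 W8.2] replaces the role of §17 ¶2, p.89 l.59–62 of H. Hironaka's manuscript
*Resolution of singularities in positive characteristics* (2017-03-23, [Hironaka2017]: «When the K has
transcendence degree d we can reformulate the resolution problem to the case of dimension d + dim Z.») by a
THEOREM about the summit's own predicate `Scheme.HasResolution` — valid for FINITELY GENERATED ground fields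
and only those (for a perfect, non-finitely-generated `K` such as `𝔽_p(t)^{perf}` no model exists; that residual
is `CampaignW82.PerfectionStepDimLe` / the kernel `CampaignW82.ClimbRatFuncPerf p`, open). NOT a statement of
the manuscript; nothing here is attributed to its author; no typed candidate of the manuscript is used, even
as a hypothesis. AI work, weaker than expert review. VACUITY: hypotheses and conclusions are instances of the
open summit predicate in the stated dimensions; nothing is vacuous.

## References (locators; the proofs use the tree's formalisations)
* A. Grothendieck, J. Dieudonné, EGA IV₃, Publ. Math. IHÉS 28 (1966), Thm. 8.8.2 (ii), 8.10.5. [EGAIV3]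
* H. Matsumura, *Commutative Ring Theory*, CUP 1987, Thm. 5.6, Thm. 15.5. [Matsumura1987]
* J. Kollár, *Lectures on Resolution of Singularities*, Ann. of Math. Stud. 166 (2007), Ch. 3 (reduction of
  resolution to finitely generated ground rings — folklore). [Kollar2007]
* H. Hironaka, ms. 2017-03-23, §17 ¶2 p.89 l.59–62 — under adjudication, quoted for the role replaced, not
  asserted. [Hironaka2017]
* plan/RESCUE-SEED.md row W8.2; L/res-L1-k82/KILL-TEST-K8.2.md §4; res-L1-type-o6 INBOX 2026-08-26T20:23:09Z.
-/
noncomputable section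

set_option linter.dupNamespace false -- mandated namespace of this single-conjunct summit

open CategoryTheory CategoryTheory.Limits AlgebraicGeometry MonoidalCategory Opposite
open TopologicalSpace
open Literature.AlgebraicGeometry.Limits Literature.AlgebraicGeometry.Morphisms
open Literature.AlgebraicGeometry.Resolution Literature.AlgebraicGeometry.Dimension
open Literature.AlgebraicGeometry.Motives (SchemeOver specOver)

namespace Summit.ResolutionOfSingularities.ResolutionOfSingularities.Theorems.CampaignW82

-- As in `Literature/AlgebraicGeometry/Limits/SubalgebraDiagram.lean` and `ClosedSubschemes.lean`:
-- the cone legs `c.π.app i` have source `((Functor.const _).obj c.pt).obj i`, definitionally `c.pt`.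
set_option backward.isDefEq.respectTransparency false

universe u

/-- **[OURS · L1 W8.2] GRADED FAMILY TRANSFER along a finitely generated field extension** (replaces the role
of §17 ¶2, p.89 l.60–62 «transcendence degree d ↦ dimension d + dim Z» for finitely generated ground fields;
NOT a statement of the manuscript). Let `k` be a field, `A` a finitely generated `k`-domain of Krull dimension
`≤ d` and `K = Frac A` (so `K/k` is finitely generated of transcendence degree `≤ d`). If every integral
separated `k`-scheme of finite type of dimension `≤ n + d` admits a resolution of singularities, then so does
every integral separated `K`-scheme of finite type of dimension `≤ n`. Proof: spread `X/K` out to an integral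
model `𝒳 → Spec R` of finite type over a finitely generated `k`-subalgebra `R ⊆ K` containing the generators
of `A` (so `Frac R = K`, `dim R = trdeg_k K = dim A ≤ d`); `dim 𝒳 ≤ dim X + dim R ≤ n + d` (dimension
inequality from the generic fibre); resolve the total space `𝒳` over `k`; the generic fibre of the resolution
resolves `X ≅ 𝒳 ×_R Spec K` (flat preimmersion base change keeps properness, birationality and regularity).
[cite: EGAIV3, Thm. 8.8.2 (ii)] [cite: Matsumura1987, Thm. 15.5] -/
theorem integralResolutionOverUpToDim_of_isFractionRing
    {k : Type u} [Field k] (A : Type u) [CommRing A] [IsDomain A] [Algebra k A]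
    [Algebra.FiniteType k A] (K : Type u) [Field K] [Algebra k K] [Algebra A K]
    [IsScalarTower k A K] [IsFractionRing A K] {n d : ℕ} (hA : ringKrullDim A ≤ d)
    (h : IntegralResolutionOverUpToDim k (n + d)) : IntegralResolutionOverUpToDim K n := by
  intro X g hsep hlft hqc hX hdim
  classical
  haveI := hsep
  haveI := hlft
  haveI := hqc
  haveI := hX
  -- ### Step 1: a model over a finitely generated `k`-subalgebra `R₀ ⊆ K`
  obtain ⟨R₀, X₀, p₀, π₀, hR₀fg, hpsep, hplft, hpqc, hsq⟩ :=
    exists_isPullback_specMap_subalgebra (K := k) (B := K) g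
  haveI := hpsep
  haveI := hplft
  haveI := hpqc
  haveI : Algebra.FiniteType k R₀ := R₀.fg_iff_finiteType.mp hR₀fg
  haveI : IsNoetherianRing R₀ := Algebra.FiniteType.isNoetherianRing k R₀
  let P : SchemeOver R₀ := Over.mk p₀
  haveI : IsSeparated P.hom := hpsep
  haveI : QuasiCompact P.hom := hpqc
  haveI : LocallyOfFiniteType P.hom := hplft
  have hsq' : IsPullback π₀ g P.hom (specOver R₀ K).hom := hsq
  let jY : X ⟶ (P ⊗ specOver (↥R₀) K).left := hsq'.isoPullback.hom
  have hg : jY ≫ pullback.snd P.hom (specOver R₀ K).hom = g := hsq'.isoPullback_hom_snd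
  -- generators of `A` over `k`, seen in `K`
  obtain ⟨sA, hsA⟩ := Algebra.FiniteType.out (R := k) (A := A)
  let tL : Finset K := sA.image (algebraMap A K)
  -- ### Step 2: `X` descends to an INTEGRAL model over a stage `R = R₀[t'] ⊆ K`, `tL ⊆ t'`
  haveI : IsLocallyNoetherian (SubalgApprox.prodCone R₀ K tL P).pt := by
    haveI : IsLocallyNoetherian (specOver R₀ K).left :=
      inferInstanceAs (IsLocallyNoetherian (Spec (.of K)))
    change IsLocallyNoetherian (pullback P.hom (specOver R₀ K).hom)
    exact LocallyOfFiniteType.isLocallyNoetherian (pullback.snd P.hom (specOver R₀ K).hom)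
  obtain ⟨i, hi⟩ := exists_isPullback_toImage_of_isLocallyNoetherian
    (SubalgApprox.prodDiagram R₀ K tL P) (SubalgApprox.prodCone R₀ K tL P)
    (SubalgApprox.isLimitProdCone R₀ K tL P) jY
  have HX := hi i (𝟙 i)
  let R : Subalgebra R₀ K := SubalgApprox.sub R₀ K i.unop.1
  let π : (P ⊗ specOver R₀ K).left ⟶ (SubalgApprox.prodDiagram R₀ K tL P).obj i :=
    (SubalgApprox.prodCone R₀ K tL P).π.app i
  have Hleg : IsPullback π (pullback.snd P.hom (specOver R₀ K).hom)
      (pullback.snd P.hom (specOver R₀ R).hom)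
      (Spec.map (CommRingCat.ofHom (algebraMap R K))) :=
    SubalgApprox.isPullback_whiskerLeft_left P ((SubalgApprox.baseCone R₀ K tL).π.app i)
  let Xt : Scheme.{u} := (jY ≫ π).image
  let πt : X ⟶ Xt := (jY ≫ π).toImage
  let ft : Xt ⟶ Spec (.of R) := (jY ≫ π).imageι ≫ pullback.snd P.hom (specOver R₀ R).hom
  let s : Spec (.of K) ⟶ Spec (.of R) := Spec.map (CommRingCat.ofHom (algebraMap R K))
  have Hmain : IsPullback πt g ft s := by
    have h := HX.flip.paste_vert Hleg
    rwa [hg] at h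
  -- `Xt` is integral, and separated of finite type over `R`
  haveI : IsIntegral Xt := ChowLemmaProof.isIntegral_image (jY ≫ π)
  haveI : IsSeparated ft := inferInstance
  haveI : LocallyOfFiniteType ft := inferInstance
  haveI : QuasiCompact ft := inferInstance
  -- ### Step 3: `R` is of finite type over `k`, so `Xt` is of finite type over `k`
  haveI : Algebra.FiniteType (↥R₀) (↥R) := SubalgApprox.finiteType_sub R₀ K i.unop.1
  haveI : IsScalarTower k (↥R₀) (↥R) := inferInstance
  haveI : Algebra.FiniteType k R := Algebra.FiniteType.trans (S := ↥R₀) inferInstance inferInstance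
  haveI : IsNoetherianRing R := Algebra.FiniteType.isNoetherianRing k R
  let b : Spec (.of R) ⟶ Spec (.of k) := Spec.map (CommRingCat.ofHom (algebraMap k R))
  haveI : LocallyOfFiniteType b := by
    rw [HasRingHomProperty.Spec_iff (P := @LocallyOfFiniteType)]
    exact RingHom.finiteType_algebraMap.mpr inferInstance
  haveI : IsSeparated (ft ≫ b) := inferInstance
  haveI : LocallyOfFiniteType (ft ≫ b) := inferInstance
  haveI : QuasiCompact (ft ≫ b) := inferInstance
  -- ### Step 4: `Frac R = K` (`R ⊇ R₀[generators of A]`), so `Spec K → Spec R` is a flat preimmersion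
  have hinj : Function.Injective (algebraMap R K) := fun x y hxy => Subtype.ext hxy
  have hAK : ∀ a : A, algebraMap A K a ∈ R := by
    intro a
    have ha : a ∈ Algebra.adjoin k (sA : Set A) := by rw [hsA]; trivial
    have hle : (Algebra.adjoin k (sA : Set A)).map (IsScalarTower.toAlgHom k A K) ≤
        R.restrictScalars k := by
      rw [AlgHom.map_adjoin]
      refine Algebra.adjoin_le ?_
      rintro _ ⟨a, ha, rfl⟩
      change algebraMap A K a ∈ R
      exact Algebra.subset_adjoin (Finset.mem_coe.2 (i.unop.2 (Finset.mem_image_of_mem _ ha)))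
    have := hle ⟨a, ha, rfl⟩
    rwa [Subalgebra.mem_restrictScalars] at this
  have hsurj : ∀ z : K, ∃ x y : R, z = algebraMap R K x / algebraMap R K y := by
    intro z
    obtain ⟨a, b, -, hab⟩ := IsFractionRing.div_surjective (A := A) z
    exact ⟨⟨_, hAK a⟩, ⟨_, hAK b⟩, hab.symm⟩
  haveI : FaithfulSMul R K := (faithfulSMul_iff_algebraMap_injective R K).mpr hinj
  haveI : IsFractionRing R K := IsFractionRing.of_field R K hsurj
  haveI : IsPreimmersion s := IsPreimmersion.of_isLocalization (nonZeroDivisors R)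
  haveI : Flat s := by
    rw [Flat.SpecMap_iff, CommRingCat.hom_ofHom]
    exact RingHom.flat_algebraMap_iff.mpr (IsLocalization.flat K (nonZeroDivisors R))
  -- ### Step 5: `dim R ≤ d` (`dim R = trdeg_k K = dim A`, Matsumura Thm. 5.6)
  have hRdim : ringKrullDim R ≤ d := by
    haveI : FaithfulSMul k R :=
      (faithfulSMul_iff_algebraMap_injective k R).mpr (algebraMap k R).injective
    haveI : FaithfulSMul k A :=
      (faithfulSMul_iff_algebraMap_injective k A).mpr (algebraMap k A).injective
    haveI : FaithfulSMul A K :=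
      (faithfulSMul_iff_algebraMap_injective A K).mpr (IsFractionRing.injective A K)
    haveI : IsScalarTower k R K := inferInstance
    haveI : Algebra.IsAlgebraic R K := IsLocalization.isAlgebraic K (nonZeroDivisors R)
    haveI : Algebra.IsAlgebraic A K := IsLocalization.isAlgebraic K (nonZeroDivisors A)
    have h1 : Algebra.trdeg k K = Algebra.trdeg k R := by
      rw [← trdeg_add_eq k R (A := K), trdeg_eq_zero (R := R) (A := K), add_zero]
    have h2 : Algebra.trdeg k K = Algebra.trdeg k A := by
      rw [← trdeg_add_eq k A (A := K), trdeg_eq_zero (R := A) (A := K), add_zero]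
    rw [Literature.RingTheory.KrullDimension.ringKrullDim_eq_trdeg k R, ← h1, h2,
      ← Literature.RingTheory.KrullDimension.ringKrullDim_eq_trdeg k A]
    exact hA
  -- ### Step 6: `dim Xt ≤ n + d` (generic fibre `X` of dimension `≤ n` over `K = Frac R`)
  have hdimXt : topologicalKrullDim Xt ≤ (n + d : ℕ) :=
    topologicalKrullDim_le_of_isPullback_genericFibre_of_irreducibleSpace hRdim ft g πt Hmain hdim
  -- ### Step 7: resolve the TOTAL SPACE `Xt` over `k`; its generic fibre resolves `X ≅ Xt ×_R Spec K`
  obtain ⟨Y, πr, hres⟩ :=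
    h Xt (ft ≫ b) inferInstance inferInstance inferInstance inferInstance hdimXt
  haveI := hres.isProper
  haveI : IsNoetherian Xt := Scheme.isNoetherian_of_finiteType_over_field (ft ≫ b)
  haveI : IsNoetherian Y := Scheme.isNoetherian_of_finiteType_over_field (πr ≫ ft ≫ b)
  exact (hasResolution_pullback_of_flat_of_surjectiveOnStalks ft s πr hres).of_iso
    Hmain.isoPullback.inv

/-- **Graded family transfer, reduced schemes**: for `k`, `A`, `K = Frac A`, `dim A ≤ d` as above,
`ResolutionOverUpToDim k (n + d) → ResolutionOverUpToDim K n` (reduced separated schemes of finite type; via the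
equivalence of each with its integral case, `resolutionOverUpToDim_iff_integral`). [folklore] -/
theorem resolutionOverUpToDim_of_isFractionRing
    {k : Type u} [Field k] (A : Type u) [CommRing A] [IsDomain A] [Algebra k A]
    [Algebra.FiniteType k A] (K : Type u) [Field K] [Algebra k K] [Algebra A K]
    [IsScalarTower k A K] [IsFractionRing A K] {n d : ℕ} (hA : ringKrullDim A ≤ d)
    (h : ResolutionOverUpToDim k (n + d)) : ResolutionOverUpToDim K n :=
  (integralResolutionOverUpToDim_of_isFractionRing A K hA h.integral).resolutionOverUpToDim

/-- **Graded family transfer, transcendence-degree form**: for fields `k ⊆ K` with `K = Frac A` for a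
finitely generated `k`-subalgebra `A ⊆ K` (i.e. `K/k` finitely generated as a field) and `trdeg_k K ≤ d`,
`IntegralResolutionOverUpToDim k (n + d) → IntegralResolutionOverUpToDim K n` (`dim A = trdeg_k K`,
Matsumura Thm. 5.6, tree `ringKrullDim_le_of_fg_of_trdeg_le`). [cite: Matsumura1987, Thm. 5.6] -/
theorem integralResolutionOverUpToDim_of_trdeg_le {k K : Type u} [Field k] [Field K] [Algebra k K]
    (A : Subalgebra k K) (hA : A.FG) [IsFractionRing A K] {n d : ℕ} (hd : Algebra.trdeg k K ≤ d)
    (h : IntegralResolutionOverUpToDim k (n + d)) : IntegralResolutionOverUpToDim K n := by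
  haveI : Algebra.FiniteType k A := A.fg_iff_finiteType.mp hA
  have hdim : ringKrullDim A ≤ d := ringKrullDim_le_of_fg_of_trdeg_le A hA hd
  exact integralResolutionOverUpToDim_of_isFractionRing (k := k) (↥A) K hdim h

/-- **One transcendental — `(n + 1, n)` at every FINITE level of the W8.2 climb**: resolution of integral
separated `k`-schemes of finite type of dimension `≤ n + 1` implies resolution of integral separated schemes of
finite type of dimension `≤ n` over the rational function field `RatFunc k` (`A = k[X]`, `dim k[X] = 1`). E.g.
`n = 4`: resolution of fivefolds over `𝔽_p` ⇒ resolution of fourfolds over `𝔽_p(t)`. [folklore] -/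
theorem integralResolutionOverUpToDim_ratFunc {k : Type u} [Field k] {n : ℕ}
    (h : IntegralResolutionOverUpToDim k (n + 1)) : IntegralResolutionOverUpToDim (RatFunc k) n :=
  integralResolutionOverUpToDim_of_isFractionRing (Polynomial k) (RatFunc k) (d := 1)
    (by rw [Polynomial.ringKrullDim_of_isNoetherianRing, ringKrullDim_eq_zero_of_field]; rfl) h

/-- The same for reduced schemes: `ResolutionOverUpToDim k (n + 1) → ResolutionOverUpToDim (RatFunc k) n`.
[folklore] -/
theorem resolutionOverUpToDim_ratFunc {k : Type u} [Field k] {n : ℕ}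
    (h : ResolutionOverUpToDim k (n + 1)) : ResolutionOverUpToDim (RatFunc k) n :=
  (integralResolutionOverUpToDim_ratFunc h.integral).resolutionOverUpToDim

/-- **`r` transcendentals at once — `(n + r, n)`**: resolution over `k` in dimension `≤ n + r` implies
resolution in dimension `≤ n` over the purely transcendental extension `Frac k[X₁, …, X_r]`
(`A = MvPolynomial (Fin r) k`, `dim = r`). [folklore] -/
theorem integralResolutionOverUpToDim_fractionRing_mvPolynomial {k : Type u} [Field k] {n : ℕ} (r : ℕ)
    (h : IntegralResolutionOverUpToDim k (n + r)) :
    IntegralResolutionOverUpToDim (FractionRing (MvPolynomial (Fin r) k)) n :=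
  integralResolutionOverUpToDim_of_isFractionRing (MvPolynomial (Fin r) k)
    (FractionRing (MvPolynomial (Fin r) k)) (d := r)
    (by
      rw [MvPolynomial.ringKrullDim_of_isNoetherianRing, ringKrullDim_eq_zero_of_field, Nat.card_eq_fintype_card,
        Fintype.card_fin, zero_add])
    h

/-- **Ungraded family transfer** (all dimensions): if every integral separated `k`-scheme of finite type has a
resolution, then so does every integral separated scheme of finite type over `K = Frac A`, `A` any finitely
generated `k`-domain — `Theorems.PrimeFieldToPerfect.stub_spreadOut` (p149455: `k = ZMod p`, `K` finitely
generated as a field) with the prime field replaced by an arbitrary ground field. In particular (`A = M[X]`)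
resolution over a field `M` gives resolution over `RatFunc M`: the finite levels of the W8.2 climb are free, the
perfect closure is the kernel. [folklore] -/
theorem integralRes_of_isFractionRing
    {k : Type u} [Field k] (A : Type u) [CommRing A] [IsDomain A] [Algebra k A]
    [Algebra.FiniteType k A] (K : Type u) [Field K] [Algebra k K] [Algebra A K]
    [IsScalarTower k A K] [IsFractionRing A K]
    (h : ∀ (X : Scheme.{u}) (f : X ⟶ Spec (.of k)), IsSeparated f → LocallyOfFiniteType f →
      QuasiCompact f → IsIntegral X → Scheme.HasResolution X)
    (X : Scheme.{u}) (f : X ⟶ Spec (.of K)) [IsSeparated f] [LocallyOfFiniteType f] [QuasiCompact f]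
    [IsIntegral X] : Scheme.HasResolution X := by
  -- `dim A` and `dim X` are finite: both are of finite type over a field
  obtain ⟨d, hd, -⟩ := exists_ringKrullDim_eq_and_trdeg_eq k A
  haveI : CompactSpace X :=
    (HasAffineProperty.iff_of_isAffine (P := @QuasiCompact)).mp ‹QuasiCompact f›
  obtain ⟨n, hn⟩ := exists_topologicalKrullDim_le_of_locallyOfFiniteType f
  exact integralResolutionOverUpToDim_of_isFractionRing A K (n := n) (d := d) hd.le
    (fun Y g hs hl hq hY _ => h Y g hs hl hq hY) X f ‹_› ‹_› ‹_› ‹_› hn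

end Summit.ResolutionOfSingularities.ResolutionOfSingularities.Theorems.CampaignW82

end
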